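import Mathlib
import Literature.Geometry.Lorentzian.ReggeWheelerTortoise
import Literature.Geometry.Lorentzian.ReggeWheelerChannels
import Summits.FinalStateConjecture.FinalStateConjecture.Theses.PhotonSphereChannels

/-!
# Sketch — crux-ideate stmt-FinalStateConjecture-14085 (`WindowedShellChannels`), ideator 1, round 1

First lemmas of the three idea cards (statements only; `def … : Prop`, no claims):
* Card `null-multiplier-lp`: `NullMultiplierIdentity`, `RindlerWindowedFlux`.
* Card `escape-direction-partition`: `RayCensus`, `WindowedShellChannelsEven/Odd`,
  `ParallelogramReduction`.
* Card `peak-cross-identity`: `SidewaysDivergence`, `outEnergy`, `PeakCrossIdentity`.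
-/

noncomputable section

namespace Summit.FinalStateConjecture.FinalStateConjecture.Cruxes.WindowedShellChannels.Ideator1

open Literature.Geometry.Lorentzian Literature.Geometry.Lorentzian.ReggeWheeler
open MeasureTheory Filter Set
open scoped ENNReal Topology

/-! ### Card C — null-separated multipliers -/

/-- Pointwise divergence identity for the null-separated multiplier `Z = a(U)∂_U + b(V)∂_V`
applied to a `C²` function with `φ_{UV} = −(𝓜/4) φ` (1+1 Klein–Gordon of mass² `𝓜` in null
coordinates; for the Regge–Wheeler equation in tortoise null coordinates `u = t − x`, `v = t + x`
one has `ψ_{uv} = −(V(x)/4) ψ`, and a position-dependent `𝓜` adds `⅛ (b − a) 𝓜′ φ²`):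
`∂_U [b φ_V² + ¼ a 𝓜 φ²] + ∂_V [a φ_U² + ¼ b 𝓜 φ²] = ¼ (a′ + b′) 𝓜 φ²`. -/
def NullMultiplierIdentity : Prop :=
  ∀ (a b : ℝ → ℝ) (𝓜 : ℝ) (φ : ℝ → ℝ → ℝ), ContDiff ℝ 2 (Function.uncurry φ) →
    Differentiable ℝ a → Differentiable ℝ b →
    (∀ U V, deriv (fun U' => deriv (φ U') V) U = -(𝓜 / 4) * φ U V) →
    (∀ U V, deriv (fun V' => deriv (fun U' => φ U' V') U) V = -(𝓜 / 4) * φ U V) →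
    ∀ U V,
      deriv (fun U' => b V * deriv (φ U') V ^ 2 + a U' * (𝓜 / 4) * φ U' V ^ 2) U
        + deriv (fun V' => a U * deriv (fun U' => φ U' V') U ^ 2 + b V' * (𝓜 / 4) * φ U V' ^ 2) V
      = (𝓜 / 4) * (deriv a U + deriv b V) * φ U V ^ 2

/-- **Windowed horizon flux in the exact Rindler model, uniform in the mass, sharp lag.**
Klein–Gordon `φ_{UV} = −(m²/4) φ` on the right wedge, `C²`, vanishing on
`{X ≥ X_e + |T|}` (`X = (V−U)/2`, `T = (U+V)/2`; data supported in `0 < X < X_e`). For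
`λ > 2` and `A = λ X_e`, the boost-energy fluxes through the EARLY horizon pieces
`{U = 0, 0 < V < A}` and `{V = 0, −A < U < 0}` satisfy
`∫₀^A V φ_V(0,V)² dV + ∫_{−A}^0 (−U) φ_U(U,0)² dU ≥ ((λ−2)/(λ−1)) · E_K`,
`E_K = ∫₀^{X_e} X (φ_U² + φ_V² + ½ m² φ²)(−X, X) dX` (the boost energy; `= 2M ×` the
Regge–Wheeler energy of the near datum under `X = 4M e^{(x−x_c)/4M}`, `λ = e^{h/4M}`). -/
def RindlerWindowedFlux : Prop :=
  ∀ (m Xe lam : ℝ), 0 < Xe → 2 < lam → ∀ φ : ℝ → ℝ → ℝ, ContDiff ℝ 2 (Function.uncurry φ) →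
    (∀ U V, deriv (fun U' => deriv (φ U') V) U = -(m ^ 2 / 4) * φ U V) →
    (∀ U V, Xe + |U + V| / 2 ≤ (V - U) / 2 → φ U V = 0) →
    ENNReal.ofReal ((lam - 2) / (lam - 1)) *
        ENNReal.ofReal (∫ X in (0 : ℝ)..Xe, X * (deriv (fun U' => φ U' X) (-X) ^ 2
          + deriv (φ (-X)) X ^ 2 + m ^ 2 / 2 * φ (-X) X ^ 2))
      ≤ ENNReal.ofReal (∫ V in (0 : ℝ)..(lam * Xe), V * deriv (φ 0) V ^ 2)
        + ENNReal.ofReal (∫ U in (-(lam * Xe))..(0 : ℝ), (-U) * deriv (fun U' => φ U' 0) U ^ 2)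

/-! ### Card A — caught-direction census and the even/odd reduction -/

/-- **Ray census off the shell (no ray enters both lagged cones).** For the bicharacteristics of
`ψ_tt − ψ_xx + V_{s,ℓ} ψ = 0` (`ẋ = ξ/ω`, `ξ̇ = −V′(x)/(2ω)`, `ω² = ξ² + V`), launched at `t = 0`
from `|x₀ − x_c| > ρ`: with a lag `h = h(M,ρ)` and margin `δ > 0`, every ray stays outside the
lagged forward cone for all `t ≥ 0` OR outside the lagged backward cone for all `t ≤ 0`,
uniformly in `s ≤ 2 ≤ …`, `ℓ ≥ max s 1`. -/
def RayCensus : Prop :=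
  ∀ M : ℝ, 0 < M → ∀ ρ : ℝ, 0 < ρ → ∃ h : ℝ, 0 ≤ h ∧ ∃ δ : ℝ, 0 < δ ∧
    ∀ (r : ℝ → ℝ) (xc : ℝ), IsTortoiseRadius M r xc → ∀ (s ℓ : ℕ), s ≤ 2 → s ≤ ℓ → 1 ≤ ℓ →
    ∀ (x ξ : ℝ → ℝ) (ω : ℝ), 0 < ω →
      (∀ t, HasDerivAt x (ξ t / ω) t) →
      (∀ t, HasDerivAt ξ (-(deriv (linePotential M s ℓ r) (x t)) / (2 * ω)) t) →
      ξ 0 ^ 2 + linePotential M s ℓ r (x 0) = ω ^ 2 → ρ < |x 0 - xc| →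
      (∀ t, 0 ≤ t → ρ - h + t + δ ≤ |x t - xc|) ∨ (∀ t, t ≤ 0 → ρ - h - t + δ ≤ |x t - xc|)

/-- One-directional form of the crux for time-SYMMETRIC data (`ψ_t(0,·) = 0`): twice the forward
lagged channel energy controls `c ·` total energy. -/
def WindowedShellChannelsEven : Prop :=
  ∀ M : ℝ, 0 < M → ∀ ρ : ℝ, 0 < ρ → ∃ h : ℝ, 0 ≤ h ∧ ∃ c : ℝ, 0 < c ∧ ∀ (r : ℝ → ℝ) (xc : ℝ),
    IsTortoiseRadius M r xc → ∀ (s ℓ : ℕ), s ≤ 2 → s ≤ ℓ → ∀ ψ : ℝ → ℝ → ℝ,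
    IsRWSolution M s ℓ r ψ → CauchyDataSupportedOn ψ {x : ℝ | ρ < |x - xc|} →
    (∀ x, deriv (fun τ => ψ τ x) 0 = 0) →
    ENNReal.ofReal c * totalEnergy (linePotential M s ℓ r) ψ 0 ≤
      2 * channelEnergy (linePotential M s ℓ r) xc (ρ - h) ψ atTop

/-- The same for time-ANTISYMMETRIC data (`ψ(0,·) = 0`). -/
def WindowedShellChannelsOdd : Prop :=
  ∀ M : ℝ, 0 < M → ∀ ρ : ℝ, 0 < ρ → ∃ h : ℝ, 0 ≤ h ∧ ∃ c : ℝ, 0 < c ∧ ∀ (r : ℝ → ℝ) (xc : ℝ),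
    IsTortoiseRadius M r xc → ∀ (s ℓ : ℕ), s ≤ 2 → s ≤ ℓ → ∀ ψ : ℝ → ℝ → ℝ,
    IsRWSolution M s ℓ r ψ → CauchyDataSupportedOn ψ {x : ℝ | ρ < |x - xc|} →
    (∀ x, ψ 0 x = 0) →
    ENNReal.ofReal c * totalEnergy (linePotential M s ℓ r) ψ 0 ≤
      2 * channelEnergy (linePotential M s ℓ r) xc (ρ - h) ψ atTop

/-- **Parallelogram reduction**: time reversal `ψ(t,x) ↦ ψ(−t,x)` exchanges `atTop`/`atBot`
channel energies and fixes even/odd data up to sign, and channel energies are limits of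
quadratic forms, so `E⁺(ψ) + E⁻(ψ) = 2E⁺(ψ_even) + 2E⁺(ψ_odd)` while `E(ψ) = E(ψ_even) + E(ψ_odd)`;
hence the crux follows from (indeed is equivalent to) its two one-directional halves. -/
def ParallelogramReduction : Prop :=
  WindowedShellChannelsEven → WindowedShellChannelsOdd →
    Summit.FinalStateConjecture.FinalStateConjecture.Theses.PhotonSphereChannels.WindowedShellChannels

/-! ### Card B — the peak-centred one-sided null-cross identity -/

/-- Sideways (x-evolution) divergence behind the null-cross identity: for a `C²` solution of
`ψ_tt − ψ_xx + Vψ = 0`, `∂_x(ψ_t² + ψ_x² − Vψ²) − ∂_t(2 ψ_t ψ_x) = −V′ ψ²`. -/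
def SidewaysDivergence : Prop :=
  ∀ (V : ℝ → ℝ) (ψ : ℝ → ℝ → ℝ), Differentiable ℝ V → IsSolution V ψ → ∀ t x,
    deriv (fun y => deriv (fun τ => ψ τ y) t ^ 2 + deriv (ψ t) y ^ 2 - V y * ψ t y ^ 2) x
      - deriv (fun τ => 2 * deriv (fun τ' => ψ τ' x) τ * deriv (ψ τ) x) t
    = -(deriv V x) * ψ t x ^ 2

/-- The **escaping energy** at time `t` relative to the peak `xp`: outgoing characteristic energy
on the far side plus ingoing characteristic energy on the near side (plus half the potential
energy); semiclassically `∫ ½(1 + v_group,outward) dμ_t`. -/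
def outEnergy (V : ℝ → ℝ) (xp : ℝ) (ψ : ℝ → ℝ → ℝ) (t : ℝ) : ℝ≥0∞ :=
  (∫⁻ x in Ioi xp, ENNReal.ofReal ((deriv (fun τ => ψ τ x) t - deriv (ψ t) x) ^ 2 / 2
      + V x * ψ t x ^ 2 / 2))
  + ∫⁻ x in Iio xp, ENNReal.ofReal ((deriv (fun τ => ψ τ x) t + deriv (ψ t) x) ^ 2 / 2
      + V x * ψ t x ^ 2 / 2)

/-- **Peak-cross identity (forward half).** For the Regge–Wheeler family, with `xp` the maximum
point of `V_{s,ℓ}` on the tortoise line (`xp = x_c` for `s = 1`) and any apex time `t₁`, every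
global finite-energy solution satisfies
`E⁺[apex (t₁, xp)] + ∫_{t>t₁} [V(xp + t − t₁) ψ(t, xp + t − t₁)² + V(xp − t + t₁) ψ(t, xp − t + t₁)²] dt
   = outEnergy(t₁) + ½ ∬_{|x − xp| > t − t₁ > 0} |V′(x)| ψ² dx dt`,
all four terms in `[0, ∞]`; the bulk is signed because the apex sits at the peak. (Here stated
with the channel energy of aperture `0` about `xp` for the time-shifted solution.) -/
def PeakCrossIdentity : Prop :=
  ∀ (M : ℝ) (r : ℝ → ℝ) (xc : ℝ), IsTortoiseRadius M r xc → ∀ (s ℓ : ℕ), s ≤ 2 → s ≤ ℓ →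
    ∀ xp : ℝ, IsMaxOn (linePotential M s ℓ r) univ xp →
    ∀ ψ : ℝ → ℝ → ℝ, IsRWSolution M s ℓ r ψ → totalEnergy (linePotential M s ℓ r) ψ 0 < ∞ →
    ∀ t₁ : ℝ,
      channelEnergy (linePotential M s ℓ r) xp 0 (fun t x => ψ (t + t₁) x) atTop
        + ∫⁻ t in Ioi t₁, ENNReal.ofReal
            (linePotential M s ℓ r (xp + (t - t₁)) * ψ t (xp + (t - t₁)) ^ 2
              + linePotential M s ℓ r (xp - (t - t₁)) * ψ t (xp - (t - t₁)) ^ 2)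
      = outEnergy (linePotential M s ℓ r) xp ψ t₁
        + ∫⁻ z in {z : ℝ × ℝ | t₁ < z.1 ∧ z.1 - t₁ < |z.2 - xp|},
            ENNReal.ofReal (|deriv (linePotential M s ℓ r) z.2| * ψ z.1 z.2 ^ 2 / 2)

end Summit.FinalStateConjecture.FinalStateConjecture.Cruxes.WindowedShellChannels.Ideator1

end
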